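import Summits.BirchSwinnertonDyer.Rank1Residual.Additive.X3BranchKummerLineClasses
import Literature.NumberTheory.GaloisRepresentations.GaloisCohomologyKummerProofs
import Literature.NumberTheory.NumberFields.AdicCompletionSquareCriteria
import HarnessLib

/-!
# X3, the DEGENERATE rows: the LOCAL behaviour of Kummer classes — `I_v` fixes the `p`-th roots of
# a `v`-unit (`v ∤ p`), a root in the completion `ℚ_v` gives a root in `ℚ̄` fixed by `D_v`, and a
# `27`-adic cube certificate gives a cube root in `ℚ_v` for `v ∣ 3` (Hensel)
# (cell `bsd-eis`, seat `bsd-eis-x3` gen 6; sequel of `X3BranchKummerLineClasses.lean`; route K1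
# `AdditiveBranchIMC`, crux `GordTwoRankZeroOffCaseOne` — supports only)

HONEST FRAMING (cell `bsd-eis`, `run/shared/lean/pub/bsd-eis/README.md` §4): the programme's target of
record is the full Birch–Swinnerton-Dyer formula for every `E/ℚ` of analytic rank `≤ 1`; this file is
local algebraic number theory for the U-side LOWER BOUND of the degenerate certificate road
(`X3BranchDegenerateEndStateCardGe.lean`): the Kummer class of a rational `Σ₀`-unit `a` must be
shown (i) unramified at every `v ∉ Σ₀ ∪ {p}` and (ii) trivial on the inertia group at `p` when `a` is
a `p`-th power in `ℚ_p`. THEOREMS ONLY (no `def`, no named fact, no `sorry`); nothing is booked; no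
label, tier or count of record moves.

* §1 `smul_eq_self_of_mem_inertia_of_pow_eq` — `I_v` fixes every `p`-th root `β` of a natural number
  `a ∉ v` for `v ∤ p` (roots of `X^p − a` are distinct modulo `𝔓 ∤ pa`; the tree's
  `IsPrimitiveRoot.pow_eq_one_of_one_sub_pow_mem`).
* §2 `exists_root_smul_eq_self_of_decomp` — if `b^p = a` in `ℚ_v` then some `p`-th root of `a` in
  `ℚ̄` is fixed by `D_v` (compatibility `ι(res σ · x) = σ · ι(x)` of the tree's `absGaloisRestrict`).
* §3 `exists_cube_eq_adicCompletion_of_dvd` — `3 ∤ c`, `27 ∣ c³ − a` ⇒ `a` is a cube in `ℚ_v`,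
  `v ∣ 3` (Hensel at `z₀ = 0` for `z + 3z² + 3z³ = (a − c³)/(9c³)`, the tree's
  `HenselianLocalRing.exists_isRoot_of_isUnit_derivative` on `𝒪_v`);
  `exists_root_smul_eq_self_of_cube_cert` — §3 + §2.

References: [Washington1997] Prop. 2.3 / Lemma 2.12 (method); [NeukirchANT1999] Ch. II (9.6);
[Cassels1986] Ch. 4 Lemma 3.1; [SerreLocalFields1979] Ch. X §3.
-/

set_option autoImplicit false

noncomputable section

open scoped Classical AddSubgroup NumberField Valued

namespace Summit.BirchSwinnertonDyer.Rank1Residual.Additive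

namespace KummerLineClasses

open NumberField IsDedekindDomain Field WeierstrassCurve Polynomial
  Literature.NumberTheory.GaloisRepresentations
  Literature.NumberTheory.EllipticCurves
  Literature.NumberTheory.EllipticCurves.GreenbergSelmer

variable {p : ℕ} [hp : Fact p.Prime]

/-! ### §1 Kummer extensions are unramified away from `p·a`: inertia fixes the `p`-th roots -/

/-- **`I_v` fixes every `p`-th root of a `v`-unit `a ∈ ℕ` for `v ∤ p`** (the Kummer extension
`ℚ(ζ_p, a^{1/p})/ℚ` is unramified outside `p·a`): `σβ = ζ^nβ` and `σβ ≡ β (mod 𝔓)` force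
`(ζ^n − 1)β ∈ 𝔓`, `β ∉ 𝔓` (as `β^p = a ∉ 𝔓`), hence `ζ^n = 1` (the `p`-th roots of unity are
distinct mod `𝔓 ∤ p`). [cite: Washington1997, Prop. 2.3 and Lemma 2.12 (method)] -/
theorem smul_eq_self_of_mem_inertia_of_pow_eq {ζ β : AlgebraicClosure ℚ} (hζ : IsPrimitiveRoot ζ p)
    {a : ℕ} (ha : a ≠ 0) (hβ : β ^ p = (a : AlgebraicClosure ℚ)) {v : HeightOneSpectrum (𝓞 ℚ)}
    (hpv : ((p : ℕ) : 𝓞 ℚ) ∉ v.asIdeal) (hav : ((a : ℕ) : 𝓞 ℚ) ∉ v.asIdeal)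
    {σ : absoluteGaloisGroup ℚ} (hσ : σ ∈ inertia v) : σ • β = β := by
  haveI : NeZero p := ⟨hp.out.ne_zero⟩
  set 𝔓 := adicCompletionPrime ℚ v with h𝔓def
  have h𝔓 : 𝔓 ∈ v.primesAbove := adicCompletionPrime_mem_primesAbove ℚ v
  haveI := h𝔓.1
  have hσ' : σ ∈ 𝔓.inertia (absoluteGaloisGroup ℚ) := by
    rw [h𝔓def, inertia_adicCompletionPrime_eq_map_absInertia]; exact hσ
  -- `β` and `ζ` as elements of `\bar ℤ`
  have haint : IsIntegral (𝓞 ℚ) ((a : ℕ) : AlgebraicClosure ℚ) := by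
    have := isIntegral_algebraMap (R := 𝓞 ℚ) (A := AlgebraicClosure ℚ) (x := ((a : ℕ) : 𝓞 ℚ))
    rwa [map_natCast] at this
  have hβint : IsIntegral (𝓞 ℚ) β := IsIntegral.of_pow hp.out.pos (by rw [hβ]; exact haint)
  have hζint : IsIntegral (𝓞 ℚ) ζ := (hζ.isIntegral hp.out.pos).tower_top
  set bI : absIntegers (𝓞 ℚ) ℚ := ⟨β, hβint⟩ with hbIdef
  set zI : absIntegers (𝓞 ℚ) ℚ := ⟨ζ, hζint⟩ with hzIdef
  have hzI : IsPrimitiveRoot zI p :=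
    IsPrimitiveRoot.of_map_of_injective (f := (absIntegers (𝓞 ℚ) ℚ).val) (by exact hζ)
      Subtype.val_injective
  obtain ⟨n, -, hσβ⟩ := exists_smul_eq_pow_mul hζ (a := (a : ℚ)) (by exact_mod_cast ha)
    (by rw [hβ, Rat.cast_natCast]) σ
  have hσbI : σ • bI = zI ^ n * bI := by
    apply Subtype.ext
    rw [integralClosure.coe_smul, Subalgebra.coe_mul, SubmonoidClass.coe_pow]
    exact hσβ
  have hmem : (zI ^ n - 1) * bI ∈ 𝔓 := by
    have h := hσ' bI
    rwa [hσbI, ← sub_one_mul] at h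
  have hbI : bI ∉ 𝔓 := fun h ↦ by
    apply absIntegers.natCast_notMem_of_mem_primesAbove hav h𝔓
    have hpow : bI ^ p ∈ 𝔓 := Ideal.pow_mem_of_mem 𝔓 h p hp.out.pos
    have heq : bI ^ p = ((a : ℕ) : absIntegers (𝓞 ℚ) ℚ) := by
      apply Subtype.ext
      rw [SubmonoidClass.coe_pow]
      change β ^ p = _
      rw [hβ]; simp
    rwa [heq] at hpow
  rcases Ideal.IsPrime.mem_or_mem ‹_› hmem with h1 | h2
  · have h1' : 1 - zI ^ n ∈ 𝔓 := by rwa [← neg_sub, neg_mem_iff]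
    have hz1 : zI ^ n = 1 :=
      hzI.pow_eq_one_of_one_sub_pow_mem (absIntegers.natCast_notMem_of_mem_primesAbove hpv h𝔓) h1'
    have hζ1 : ζ ^ n = 1 := by
      have := congrArg (fun z : absIntegers (𝓞 ℚ) ℚ ↦ (z : AlgebraicClosure ℚ)) hz1
      simpa using this
    rw [hσβ, hζ1, one_mul]
  · exact absurd h2 hbI

/-! ### §2 A root in the completion `ℚ_v` gives a root in `ℚ̄` fixed by the decomposition group -/

/-- **If `a` is a `p`-th power in the completion `ℚ_v` then some `p`-th root of `a` in `ℚ̄` is fixed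
by the decomposition group `D_v`** (the one of the tree's chosen embedding `ℚ̄ → \bar ℚ_v`): the
embedded root `ι(β)` and `b ∈ ℚ_v` differ by a `p`-th root of unity `ι(ζ)^j`, so `ι(ζ^{p−j}β) = b`
is fixed by `Γ_{ℚ_v}`, and `ι(res σ · x) = σ · ι(x)`. [cite: NeukirchANT1999, Ch. II (9.6)] -/
theorem exists_root_smul_eq_self_of_decomp {ζ β : AlgebraicClosure ℚ} (hζ : IsPrimitiveRoot ζ p)
    {a : ℚ} (ha : a ≠ 0) (hβ : β ^ p = (a : AlgebraicClosure ℚ)) (v : HeightOneSpectrum (𝓞 ℚ))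
    (b : v.adicCompletion ℚ) (hb : b ^ p = algebraMap ℚ (v.adicCompletion ℚ) a) :
    ∃ β' : AlgebraicClosure ℚ, β' ^ p = (a : AlgebraicClosure ℚ) ∧ ∀ σ ∈ decomp v, σ • β' = β' := by
  have hb0 : b ≠ 0 := by
    intro h
    rw [h, zero_pow hp.out.ne_zero, eq_comm, map_eq_zero] at hb
    exact ha hb
  set ι := absClosureEmbedding ℚ (v.adicCompletion ℚ) with hι
  set b' : AlgebraicClosure (v.adicCompletion ℚ) :=
    algebraMap (v.adicCompletion ℚ) (AlgebraicClosure (v.adicCompletion ℚ)) b with hb'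
  have hb'0 : b' ≠ 0 := fun h ↦ hb0
    ((algebraMap (v.adicCompletion ℚ) (AlgebraicClosure (v.adicCompletion ℚ))).injective
      (by rw [map_zero]; exact h))
  -- `ι β / b'` is a `p`-th root of unity, hence a power of `ι ζ`
  have hιβ : ι β ^ p = b' ^ p := by
    rw [← map_pow, hβ, map_ratCast, hb', ← map_pow, hb, eq_ratCast, map_ratCast]
  have hζ' : IsPrimitiveRoot (ι ζ) p := hζ.map_of_injective ι.injective
  obtain ⟨j, hj, hζj⟩ := hζ'.eq_pow_of_pow_eq_one (ξ := ι β / b')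
    (by rw [div_pow, hιβ, div_self (pow_ne_zero _ hb'0)])
  have hιβ' : ι (ζ ^ (p - j) * β) = b' := by
    rw [map_mul, map_pow]
    have e : ι β = ι ζ ^ j * b' := by rw [hζj, div_mul_cancel₀ _ hb'0]
    rw [e, ← mul_assoc, ← pow_add, Nat.sub_add_cancel hj.le, hζ'.pow_eq_one, one_mul]
  refine ⟨ζ ^ (p - j) * β, ?_, fun σ hσ ↦ ?_⟩
  · rw [mul_pow, ← pow_mul, mul_comm (p - j), pow_mul, hζ.pow_eq_one, one_pow, one_mul, hβ]
  · obtain ⟨τ, rfl⟩ := hσ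
    have key : ι (absGaloisRestrict ℚ (v.adicCompletion ℚ) τ • (ζ ^ (p - j) * β)) =
        ι (ζ ^ (p - j) * β) := by
      rw [absGaloisRestrict_apply_smul, hιβ', hb', absoluteGaloisGroup.smul_def, AlgEquiv.commutes]
    exact ι.injective key

/-! ### §3 Hensel at `3`: a `27`-adic cube certificate gives a cube root in `ℚ_v`, `v ∣ 3` -/

/-- **Cube roots in `ℚ₃` from a certificate.** For the place `v ∣ 3` of `ℚ` and integers `a`, `c`
with `3 ∤ c` and `27 ∣ c³ − a`, `a` is a cube in the completion `ℚ_v`: writing `b = c(1 + 3z)`,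
`b³ = a` becomes `z + 3z² + 3z³ = (a − c³)/(9c³)`, solved in `𝒪_v` by Hensel's lemma at `z₀ = 0`
(derivative `1`, value `≡ 0 mod 3`). [cite: Cassels1986, Ch. 4 Lemma 3.1] -/
theorem exists_cube_eq_adicCompletion_of_dvd (v : HeightOneSpectrum (𝓞 ℚ))
    (h3v : ((3 : ℕ) : 𝓞 ℚ) ∈ v.asIdeal) {a c : ℤ} (hc : ¬ (3 : ℤ) ∣ c)
    (hcert : (27 : ℤ) ∣ c ^ 3 - a) :
    ∃ b : v.adicCompletion ℚ, b ^ 3 = algebraMap ℚ (v.adicCompletion ℚ) a := by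
  haveI : HenselianLocalRing 𝒪[v.adicCompletion ℚ] :=
    inferInstanceAs (HenselianLocalRing (v.adicCompletionIntegers ℚ))
  have hint : (Valued.v (R := v.adicCompletion ℚ)).Integers 𝒪[v.adicCompletion ℚ] :=
    Valuation.integer.integers _
  have hvalO : ∀ n : ℤ, Valued.v (((n : 𝒪[v.adicCompletion ℚ]) : v.adicCompletion ℚ)) =
      v.intValuation (n : 𝓞 ℚ) := fun n => by
    rw [← Literature.NumberTheory.NumberFields.valued_intCast_adicCompletion v n]
    simp
  -- `3 ∈ 𝔪_v`, `c ∈ 𝒪_vˣ`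
  have h3m : ((3 : ℤ) : 𝒪[v.adicCompletion ℚ]) ∈ IsLocalRing.maximalIdeal 𝒪[v.adicCompletion ℚ] := by
    rw [IsLocalRing.mem_maximalIdeal, mem_nonunits_iff, hint.isUnit_iff_valuation_eq_one]
    apply ne_of_lt
    change Valued.v ((((3 : ℤ) : 𝒪[v.adicCompletion ℚ])) : v.adicCompletion ℚ) < 1
    rw [hvalO, HeightOneSpectrum.intValuation_lt_one_iff_mem]
    exact_mod_cast h3v
  have hcu : IsUnit ((c : ℤ) : 𝒪[v.adicCompletion ℚ]) := by
    rw [hint.isUnit_iff_valuation_eq_one]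
    change Valued.v ((((c : ℤ) : 𝒪[v.adicCompletion ℚ])) : v.adicCompletion ℚ) = 1
    rw [hvalO]
    refine HeightOneSpectrum.intValuation_eq_one_iff.2 fun h ↦ hc ?_
    exact (Literature.NumberTheory.NumberFields.intCast_mem_asIdeal_iff_of_natCast_mem
      Nat.prime_three v h3v c).1 h
  -- the data: `a = c³ + 27 k`, `w = 3k / c³`
  obtain ⟨k, hk⟩ := hcert
  set R := 𝒪[v.adicCompletion ℚ] with hR
  set ci : R := ↑hcu.unit⁻¹ with hci
  have hcci : (c : R) * ci = 1 := by rw [hci]; exact hcu.mul_val_inv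
  set w : R := 3 * (-(k : R)) * ci ^ 3 with hw
  -- Hensel for `F(z) = z + 3 z² + 3 z³ - w` at `z₀ = 0`
  set F : R[X] := X + C 3 * X ^ 2 + C 3 * X ^ 3 - C w with hF
  have hF0 : F.eval 0 ∈ IsLocalRing.maximalIdeal R := by
    have : F.eval 0 = -w := by simp [hF]
    rw [this, hw]
    refine neg_mem (Ideal.mul_mem_right _ _ (Ideal.mul_mem_right _ _ ?_))
    exact_mod_cast h3m
  have hF1 : IsUnit (F.derivative.eval 0) := by
    have : F.derivative.eval 0 = 1 := by
      simp [hF]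
    rw [this]; exact isUnit_one
  obtain ⟨z, hz, -⟩ := HenselianLocalRing.exists_isRoot_of_isUnit_derivative F 0 hF0 hF1
  have hz' : z + 3 * z ^ 2 + 3 * z ^ 3 = w := by
    have h := hz
    rw [Polynomial.IsRoot, hF] at h
    simp only [eval_sub, eval_add, eval_mul, eval_X, eval_C, eval_pow] at h
    exact sub_eq_zero.mp h
  -- `b = c (1 + 3 z)`
  refine ⟨(((c : R) * (1 + 3 * z) : R) : v.adicCompletion ℚ), ?_⟩
  have hb : ((c : R) * (1 + 3 * z)) ^ 3 = (a : R) := by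
    have ha : (a : R) = (c : R) ^ 3 - 27 * k := by
      have := congrArg (Int.cast : ℤ → R) hk; push_cast at this ⊢; linear_combination -this
    rw [ha]
    have e : ((c : R) * (1 + 3 * z)) ^ 3 = (c : R) ^ 3 + 9 * (c : R) ^ 3 * (z + 3 * z ^ 2 + 3 * z ^ 3) := by
      ring
    have hcube : ((c : R) * ci) ^ 3 = 1 := by rw [hcci, one_pow]
    rw [e, hz', hw]
    linear_combination (-27 * (k : R)) * hcube
  have h := congrArg (fun t : R => (t : v.adicCompletion ℚ)) hb
  simp only [SubmonoidClass.coe_pow] at h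
  rw [h]
  simp

/-- **The local condition at `3` from a certificate.** `v ∣ 3`, `a, c ∈ ℤ`, `3 ∤ c`, `27 ∣ c³ − a`,
`ζ` a primitive cube root of unity in `ℚ̄`: some cube root `β'` of `a` in `ℚ̄` is fixed by the
decomposition group `D_v` (§3 + §2). [cite: Cassels1986, Ch. 4 Lemma 3.1] -/
theorem exists_root_smul_eq_self_of_cube_cert [Fact (Nat.Prime 3)] {ζ : AlgebraicClosure ℚ}
    (hζ : IsPrimitiveRoot ζ 3) (v : HeightOneSpectrum (𝓞 ℚ)) (h3v : ((3 : ℕ) : 𝓞 ℚ) ∈ v.asIdeal)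
    {a c : ℤ} (ha : a ≠ 0) (hc : ¬ (3 : ℤ) ∣ c) (hcert : (27 : ℤ) ∣ c ^ 3 - a) :
    ∃ β' : AlgebraicClosure ℚ, β' ^ 3 = ((a : ℚ) : AlgebraicClosure ℚ) ∧
      ∀ σ ∈ decomp v, σ • β' = β' := by
  obtain ⟨b, hb⟩ := exists_cube_eq_adicCompletion_of_dvd v h3v hc hcert
  obtain ⟨β, hβ⟩ := IsAlgClosed.exists_pow_nat_eq ((a : ℚ) : AlgebraicClosure ℚ) (by norm_num : 0 < 3)
  exact exists_root_smul_eq_self_of_decomp (p := 3) hζ (a := (a : ℚ)) (by exact_mod_cast ha) hβ v b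
    (by rw [hb, map_intCast])

end KummerLineClasses

end Summit.BirchSwinnertonDyer.Rank1Residual.Additive
end
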